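import Mathlib
import HarnessLib
import Summits.Langlands.Langlands.Theses.ParityBlindBianchi
import Literature.Analysis.FunctionSpaces.BesselKProductMellin
noncomputable section
set_option linter.dupNamespace false
namespace Summit.Langlands.Langlands.Theorems.QuadraticBaseChangeGL2

/-!
# The `K × K` Mellin formula (registered stub `stub_besselK_mul_besselK_mellin` of the line `Sketch`)

The special-function input of the archimedean `GL₂ × GL₂` Rankin–Selberg Γ-identity (Humphries–Jo,
clause (i), consumed by `stub_archRankinSelbergGammaGL2_of_besselMellin`): for complex `μ, ν, s` with
`re s > |re μ| + |re ν|`, `y ↦ y^{s-1} K_μ(y) K_ν(y)` is integrable on `(0, ∞)` and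

  `∫₀^∞ y^{s-1} K_μ(y) K_ν(y) dy = 2^{s-3} Γ((s+μ+ν)/2) Γ((s+μ-ν)/2) Γ((s-μ+ν)/2) Γ((s-μ-ν)/2) / Γ(s)`

(`K_ν = Literature.Analysis.FunctionSpaces.besselK`, the tree's Macdonald function). Both halves are
PROVED in `Literature/Analysis/FunctionSpaces/BesselKProductMellin.lean`
(`integrableOn_cpow_mul_besselK_mul_besselK`, `integral_cpow_mul_besselK_mul_besselK`; route: Watson
§13.72 (1) — `4K_μK_ν = ∫∫ e^{-y(cosh t + cosh t')} e^{μt+νt'}`, Fubini, the Gamma integral in `y`,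
the substitution `t ± t' = 2a, 2b` with `cosh t + cosh t' = 2cosh a cosh b`, the two `cosh`-moments
`2^{s-1}B((s±(μ±ν))/2, …)` and `B = ΓΓ/Γ(s)`); this file is the ten-line application.
-/

/-- **The Mellin transform of a product of two Macdonald functions** (registered stub
`stub_besselK_mul_besselK_mellin`): for `re s > |re μ| + |re ν|`, integrability of
`y ↦ y^{s-1} K_μ(y) K_ν(y)` on `(0,∞)` and
`∫₀^∞ y^{s-1} K_μ(y) K_ν(y) dy = 2^{s-3} Γ((s+μ+ν)/2)Γ((s+μ-ν)/2)Γ((s-μ+ν)/2)Γ((s-μ-ν)/2)/Γ(s)`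
(Gradshteyn–Ryzhik 6.576.4 at `a = b`; Watson §13.72 (1) with §13.21 (8); check `μ = ν = ½`:
both sides are `π 2^{-s} Γ(s-1)`), by `integrableOn_cpow_mul_besselK_mul_besselK` and
`integral_cpow_mul_besselK_mul_besselK` of `Literature/Analysis/FunctionSpaces/BesselKProductMellin.lean`.
[cite: Watson1944, §13.72 (1), PDF pp. 424–425] [cite: Watson1944, §13.21 (8), PDF p. 371] -/
theorem stub_besselK_mul_besselK_mellin : ∀ (μ ν s : ℂ), |μ.re| + |ν.re| < s.re →
      MeasureTheory.IntegrableOn (fun y : ℝ => (y : ℂ) ^ (s - 1) *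
        (Literature.Analysis.FunctionSpaces.besselK μ y * Literature.Analysis.FunctionSpaces.besselK ν y))
        (Set.Ioi 0) ∧
      ∫ y in Set.Ioi (0 : ℝ), (y : ℂ) ^ (s - 1) *
          (Literature.Analysis.FunctionSpaces.besselK μ y * Literature.Analysis.FunctionSpaces.besselK ν y) =
        (2 : ℂ) ^ (s - 3) * (Complex.Gamma ((s + μ + ν) / 2) * Complex.Gamma ((s + μ - ν) / 2) *
          Complex.Gamma ((s - μ + ν) / 2) * Complex.Gamma ((s - μ - ν) / 2)) / Complex.Gamma s :=
  fun _μ _ν _s h =>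
    ⟨Literature.Analysis.FunctionSpaces.integrableOn_cpow_mul_besselK_mul_besselK h,
      Literature.Analysis.FunctionSpaces.integral_cpow_mul_besselK_mul_besselK h⟩

end Summit.Langlands.Langlands.Theorems.QuadraticBaseChangeGL2

end
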